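/-
Origin: expansion seat `planner-pub-hodgecm-pv09-g3-0`, handover (12) 2026-08-18T06:18:24Z (`HOME/pub-hodgecm-pv09-g3/lean/Pv09g3/OrbitContinuity.lean`, md5 1f67f184, 201 lines);
landed by the gen-6 packager in gate run 24 as `HodgeCM/PerL34/OrbitContinuity.lean` (import ^import Pv[0-9]+g[0-9]+\.→import HodgeCM.PerL34. ×1).
-/
/-
Copyright: HodgeCM publication cell (pub-hodgecm), DAG node N31 — seam (I) / S3 (prover pv09, gen 3).
Released under the package licence.

# Continuity of the orbit map `y ↦ ω(y)φ` from LOCAL strong continuity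

Source under adjudication (NOT cited; this file PROVES a reduction of one hypothesis of the seam):
PerL v5, Lemma 4.2(b) proof, tex ll. 608–611 (`φ = ⊗ φ_v`, the local Weil representations `ω_v`).

The end theorem of this seat's S3 package (`PureTensor.theta_ne_zero_haarCpt_of_places`,
`HaarVolume.lean`) carries the hypothesis `Continuous (fun y => ω y φ)` — strong continuity of the
(posited, D4/D5) representation `ω` of `Πʳ_i [G_i, B_i]` at the vector `φ`.  It is NOT a consequence
of the `K_T`-fixedness `hK` alone (`K_T` is `{1}` at the places of `T`, hence not open), but it IS a
consequence of `hK` together with strong continuity of each LOCAL component `g ↦ ω(ι_i g)`: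

* `continuous_apply_of_isometry` — if `x ↦ U_x v` is continuous for every vector `v` (strong
  operator topology) and the `U_x` are isometries, then `x ↦ U_x (ψ x)` is continuous for every
  continuous `ψ` (the `ε/2` argument `‖U_x ψ_x − U_{x₀} ψ_{x₀}‖ ≤ ‖ψ_x − ψ_{x₀}‖ + ‖(U_x − U_{x₀}) ψ_{x₀}‖`);
* `continuous_orbit_prod` — hence `y ↦ ω(∏_{i∈F} ι_i(y_i)) v` is continuous on `Π_i G_i` for every
  finite `F` (induction on `F`);
* `continuous_orbit` — and `y ↦ ω(y) φ` is continuous on the restricted product: by the universal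
  property of its topology (`RestrictedProduct.continuous_dom`) it suffices to check each piece
  `{y | ∀ i ∈ S, y_i ∈ B_i}` (`S` cofinite), where `y = e_F(y|_F) · k` with `F = Sᶜ ∪ T`, `k ∈ K_F ≤ K_T`,
  so `ω(y)φ = ω(e_F(y|_F)) φ` (`hK`), continuous in `y|_F`;
* `theta_ne_zero_local_of_places` — the end theorem with `Continuous (fun y => ω y φ)` replaced by
  `∀ i v, Continuous (fun g => ω (ι_i g) v)`.

Mathlib + this seat's files only; nothing cited; no hypothesis names PerL, QW8 or a 2001-programme
claim.  Axioms: the standard trio.  Unit `pub-hodgecm-pv09-g3`, 2026-08-18.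
-/
import Summits.HodgeConjecture.HodgeCM.PerL34.HaarVolume

set_option autoImplicit false

noncomputable section

open MeasureTheory Filter Topology
open scoped RestrictedProduct InnerProductSpace

namespace HodgeCM.PerL34.PureTensor

open HodgeCM.PerL34.AdelicFactorisation HodgeCM.PerL34.RestrictedMeasure
  HodgeCM.PerL34.NoSmallSubgroups HodgeCM.PerL34.EulerFactorisation

universe u v

/-! ## §1 Joint continuity from strong continuity, for isometries -/

section sot

variable {X : Type*} [TopologicalSpace X] {Sp : Type*} [NormedAddCommGroup Sp]
  [InnerProductSpace ℂ Sp]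

/-- If `x ↦ U_x v` is continuous for every `v` and the `U_x` are (linear) isometries, then
`x ↦ U_x (ψ x)` is continuous for every continuous `ψ`. -/
theorem continuous_apply_of_isometry (U : X → (Sp ≃ₗᵢ[ℂ] Sp)) (ψ : X → Sp)
    (hU : ∀ v, Continuous fun x => U x v) (hψ : Continuous ψ) :
    Continuous fun x => U x (ψ x) := by
  rw [continuous_iff_continuousAt]
  intro x₀
  rw [ContinuousAt, tendsto_iff_norm_sub_tendsto_zero]
  have h1 : Tendsto (fun x => ‖ψ x - ψ x₀‖) (𝓝 x₀) (𝓝 0) :=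
    tendsto_iff_norm_sub_tendsto_zero.1 (hψ.tendsto x₀)
  have h2 : Tendsto (fun x => ‖U x (ψ x₀) - U x₀ (ψ x₀)‖) (𝓝 x₀) (𝓝 0) :=
    tendsto_iff_norm_sub_tendsto_zero.1 ((hU (ψ x₀)).tendsto x₀)
  refine squeeze_zero (fun _ => norm_nonneg _) (fun x => ?_) (by simpa using h1.add h2)
  calc ‖U x (ψ x) - U x₀ (ψ x₀)‖
      = ‖(U x (ψ x) - U x (ψ x₀)) + (U x (ψ x₀) - U x₀ (ψ x₀))‖ := by rw [sub_add_sub_cancel]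
    _ ≤ ‖U x (ψ x) - U x (ψ x₀)‖ + ‖U x (ψ x₀) - U x₀ (ψ x₀)‖ := norm_add_le _ _
    _ = ‖ψ x - ψ x₀‖ + ‖U x (ψ x₀) - U x₀ (ψ x₀)‖ := by
        rw [← map_sub, LinearIsometryEquiv.norm_map]

end sot

/-! ## §2 The orbit map on finite products and on the restricted product -/

section orbit

variable {ι : Type u} {G : ι → Type v} [∀ i, CommGroup (G i)] [∀ i, TopologicalSpace (G i)]
  [DecidableEq ι]
  {Sub : ι → Type*} [∀ i, SetLike (Sub i) (G i)] [∀ i, SubgroupClass (Sub i) (G i)]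
  (B : ∀ i, Sub i)
  {Sp : Type*} [NormedAddCommGroup Sp] [InnerProductSpace ℂ Sp]
  (ω : (Πʳ j, [G j, B j]) →* (Sp ≃ₗᵢ[ℂ] Sp))

/-- `y ↦ ω(∏_{i∈F} ι_i(y_i)) v` is continuous on `Π_i G_i` when every local component
`g ↦ ω(ι_i g)` is strongly continuous. -/
theorem continuous_orbit_prod
    (hloc : ∀ (i : ι) (v : Sp), Continuous fun g : G i => ω (RestrictedProduct.mulSingle B i g) v)
    (F : Finset ι) (v : Sp) :
    Continuous fun y : (∀ i, G i) => ω (∏ i ∈ F, RestrictedProduct.mulSingle B i (y i)) v := by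
  induction F using Finset.induction_on generalizing v with
  | empty =>
      simp only [Finset.prod_empty, map_one, LinearIsometryEquiv.coe_one, id_eq]
      exact continuous_const
  | insert a F ha ih =>
      simp only [Finset.prod_insert ha, map_mul, LinearIsometryEquiv.coe_mul, Function.comp_apply]
      exact continuous_apply_of_isometry (fun y : (∀ i, G i) => ω (RestrictedProduct.mulSingle B a (y a)))
        _ (fun w => (hloc a w).comp (continuous_apply a)) (ih v)

/-- **Continuity of the orbit map from local strong continuity.**  If `φ` is fixed by the box
subgroup `K_T` and every local component `g ↦ ω(ι_i g)` is strongly continuous, then `y ↦ ω(y) φ`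
is continuous on the restricted product `Πʳ_i [G_i, B_i]`. -/
theorem continuous_orbit (φ : Sp) {T : Finset ι}
    (hK : ∀ k ∈ RestrictedProduct.boxSubgroup B T, ω k φ = φ)
    (hloc : ∀ (i : ι) (v : Sp), Continuous fun g : G i => ω (RestrictedProduct.mulSingle B i g) v) :
    Continuous fun y : Πʳ j, [G j, B j] => ω y φ := by
  rw [RestrictedProduct.continuous_dom]
  intro S hS
  have hfin : Sᶜ.Finite := by
    have hmem : S ∈ (cofinite : Filter ι) := le_principal_iff.1 hS
    exact mem_cofinite.1 hmem
  set F : Finset ι := hfin.toFinset ∪ T with hF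
  have hTF : T ⊆ F := Finset.subset_union_right
  -- factorisation through `e_F`
  have key : ∀ x : Πʳ j, [G j, B j]_[𝓟 S],
      ω (RestrictedProduct.inclusion _ _ hS x) φ
        = ω (extendOne B F fun i : ↥F => x (i : ι)) φ := by
    intro x
    set a : Πʳ j, [G j, B j] := RestrictedProduct.inclusion _ _ hS x with ha
    have hk : (extendOne B F fun i : ↥F => x (i : ι))⁻¹ * a ∈ RestrictedProduct.boxSubgroup B T := by
      refine boxSubgroup_antitone B hTF (extendOne_inv_mul_mem_boxSubgroup B F _ a
        (fun i _ => rfl) (fun i hi => ?_))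
      have hiS : i ∈ S := by
        by_contra h
        exact hi (Finset.mem_union_left _ (hfin.mem_toFinset.2 h))
      exact (eventually_principal.1 x.2) i hiS
    calc ω a φ = ω (extendOne B F (fun i : ↥F => x (i : ι)) *
          ((extendOne B F fun i : ↥F => x (i : ι))⁻¹ * a)) φ := by rw [mul_inv_cancel_left]
      _ = ω (extendOne B F fun i : ↥F => x (i : ι))
            (ω ((extendOne B F fun i : ↥F => x (i : ι))⁻¹ * a) φ) := by
          rw [map_mul, LinearIsometryEquiv.coe_mul, Function.comp_apply]
      _ = ω (extendOne B F fun i : ↥F => x (i : ι)) φ := by rw [hK _ hk]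
  -- continuity of the factorised map
  have hcont : Continuous fun x : Πʳ j, [G j, B j]_[𝓟 S] =>
      ω (extendOne B F fun i : ↥F => x (i : ι)) φ := by
    have h1 : Continuous fun x : Πʳ j, [G j, B j]_[𝓟 S] => ((fun i => x i) : ∀ i, G i) :=
      continuous_pi fun i => RestrictedProduct.continuous_eval i
    have h2 := (continuous_orbit_prod B ω hloc F φ).comp h1
    refine h2.congr fun x => ?_
    simp only [Function.comp_apply]
    rw [extendOne_eq_prod, Finset.prod_coe_sort F fun i => RestrictedProduct.mulSingle B i (x i)]
  exact hcont.congr fun x => (key x).symm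

end orbit

/-! ## §3 The end theorem of the seam with LOCAL strong continuity -/

section local_end

open ComplexConjugate

variable {ι : Type} {G : ι → Type} [∀ i, CommGroup (G i)] [∀ i, TopologicalSpace (G i)]
  [∀ i, IsTopologicalGroup (G i)] [∀ i, T2Space (G i)] [∀ i, SecondCountableTopology (G i)]
  [∀ i, LocallyCompactSpace (G i)] [∀ i, MeasurableSpace (G i)] [∀ i, BorelSpace (G i)]
  [Countable ι] [DecidableEq ι]
  (B : ∀ i, Subgroup (G i)) (hBc : ∀ i, IsCompact (B i : Set (G i)))
  (hBo : ∀ i, IsOpen (B i : Set (G i))) (S₀ : Finset ι)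
  {Sp : Type} [NormedAddCommGroup Sp] [InnerProductSpace ℂ Sp]
  {E : Type*} [NormedAddCommGroup E] [InnerProductSpace ℂ E]
  (ω : (Πʳ j, [G j, B j]) →* (Sp ≃ₗᵢ[ℂ] Sp)) (φ : Sp) (hφ : ‖φ‖ = 1)
  (hloc : ∀ (i : ι) (v : Sp), Continuous fun g : G i => ω (RestrictedProduct.mulSingle B i g) v)
  (χ : (Πʳ j, [G j, B j]) →* Circle) (hχ : Continuous χ)
  (𝓕 : Set (Πʳ j, [G j, B j])) (h𝓕c : IsCompact 𝓕) (h𝓕i : (interior 𝓕).Nonempty)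
  (K : (Πʳ j, [G j, B j]) → (Πʳ j, [G j, B j]) → ℂ) (c : ℝ) (c_pos : 0 < c) (θ : E) (Θ : Set E)
  (hθ : θ ∈ Θ)
  (hN31e : RallisIP.N31e_statement (haarDatum B hBc hBo S₀).μ 𝓕 ω φ
    (fun y => ((χ y : Circle) : ℂ)) K (c : ℂ))
  (hnorm : ⟪θ, θ⟫_ℂ = ∫ u in 𝓕, ∫ u' in 𝓕, ((χ u : Circle) : ℂ) * conj ((χ u' : Circle) : ℂ) *
    K u u' ∂(haarDatum B hBc hBo S₀).μ ∂(haarDatum B hBc hBo S₀).μ)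
  {T T' : Finset ι} (hK : ∀ k ∈ RestrictedProduct.boxSubgroup B T, ω k φ = φ)
  (hχT' : RestrictedProduct.boxSubgroup B T' ≤ χ.ker)
  (hM : ∀ S : Finset ι, T ⊆ S → ∀ y : (i : ↥S) → G i,
    inner ℂ φ (ω (extendOne B S y) φ) = ∏ i : ↥S, localCoeff B ω φ i (y i))
  {S : Finset ι} {q : ι → ℕ} {chiPi nuPi : ι → ℂ} {IsSplit : ι → Prop}
  (X : UnramifiedPlaceData B (haarDatum B hBc hBo S₀) ω φ χ S q chiPi nuPi IsSplit)
  (hTS : T ⊆ S) (hT'S : T' ⊆ S)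
  (hclS : ∀ i ∈ S, Integrable (localCoeff B ω φ i) ((haarDatum B hBc hBo S₀).ν i))
  (ram_pos : ∀ i ∈ S, 0 < (localIntegrand B (haarDatum B hBc hBo S₀) ω φ χ i).I)

include hφ hloc hχ h𝓕c h𝓕i c_pos hθ hN31e hnorm hK hχT' hM X hTS hT'S hclS ram_pos

/-- **Non-vanishing of `θ`, canonical Haar data, compact fundamental domain, LOCAL strong
continuity of `ω`** (instead of global strong continuity at `φ`), `summable_t` as a hypothesis. -/
theorem theta_ne_zero_local
    (hsum : Summable fun i : {j : ι // j ∉ S} => EulerProduct.tOf (q i.1)) : θ ≠ 0 :=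
  theta_ne_zero_haarCpt B hBc hBo S₀ ω φ hφ (continuous_orbit B ω φ hK hloc) χ hχ 𝓕 h𝓕c h𝓕i K c
    c_pos θ Θ hθ hN31e hnorm hK hχT' hM X hTS hT'S hclS ram_pos hsum

/-- **The same over the finite places of a number field** (`summable_t` discharged by pv13's
`EulerProduct.summable_tOf_of_places`). -/
theorem theta_ne_zero_local_of_places (L₀ : Type*) [Field L₀] [NumberField L₀]
    (e : {j : ι // j ∉ S} → IsDedekindDomain.HeightOneSpectrum (NumberField.RingOfIntegers L₀))
    (he : Function.Injective e)
    (hq : ∀ j : {j : ι // j ∉ S}, q j.1 = Ideal.absNorm (e j).asIdeal) : θ ≠ 0 :=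
  theta_ne_zero_local B hBc hBo S₀ ω φ hφ hloc χ hχ 𝓕 h𝓕c h𝓕i K c c_pos θ Θ hθ hN31e hnorm hK hχT'
    hM X hTS hT'S hclS ram_pos (EulerProduct.summable_tOf_of_places L₀ e he hq)

end local_end

end HodgeCM.PerL34.PureTensor
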